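import Summits.BirchSwinnertonDyer.Rank1Residual.P2.CongruentNumberOddAokiMonskySevenRank
import HarnessLib

/-!
# Cell `bsd-monsky`: AOKI = MONSKY, THE ODD CLASS `n ≡ 7 (mod 8)` — the theorem:
# `selmerDimFormula (p₁⋯p_k) = 2 + s_odd(p₁⋯p_k)` for every square-free `n = p₁⋯p_k ≡ 7 (mod 8)`; with the classes
# `6` and `3 (mod 8)` this is «Aoki 1999 Thm 2.2 ≡ Monsky's matrix count» on Aoki's whole typed range (nothing asserted)

HONEST FRAMING (cell `bsd-monsky`, run/shared/lean/pub/bsd-monsky/, README §1: nothing here is part of the cell's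
Theorem 1.1/1.2). This file asserts NO arithmetic fact. It assembles, for EVERY `k` and every injective family of
primes with `n = p₁⋯p_k ≡ 7 (mod 8)`, the identity `selmerDimFormula n = 2 + monskySelmerRankOdd p` from: the odd
kernel count (`…OddAokiMonskyKernel.lean`), `Λ_{S,T} ≅ [C | t]` and `rank(G|W₇) + 2·[t ∉ col C] = rank(G|W₀)`
(`…OddAokiMonskySevenRank.lean`), Aoki's essential space for `n ≡ 7` = `W₀ ∩ ker(t ⬝ ·) ∩ ker(ε ⬝ ·)`
(`essentialCond_prod_seven_iff`, `…SevenPrep.lean`), and `|T| = |T₁| + 1`. Together with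
`selmerDimFormula_two_mul_prod` (`n ≡ 6`) and `selmerDimFormula_prod_three` (`n ≡ 3`): **Aoki's Theorem 2.2 and
Monsky's appendix to Heath-Brown 1994 agree identically on every square-free `n ≡ 3, 6, 7 (mod 8)`, every number of
prime factors** — a kernel consistency theorem between two published `2`-descents; from `hAo` alone
`#Sel₂(E_{p₁⋯p_k}) = 2^{2 + s_odd}` on `n ≡ 7 (mod 8)` (`card_selmerGroup_two_prod_seven_of_aoki`).

References: [Aoki1999] Thm. 2.2 p. 81, proof p. 98, Thm. 4.1 p. 87; [HeathBrown1994SelmerCongruentII] Appendix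
(Monsky), typescript p. 39 L10–L33; [IrelandRosen1990] Ch. 5 §§1–2.
-/

noncomputable section

open scoped Classical

open Matrix WeierstrassCurve Literature.NumberTheory.EllipticCurves
  Literature.NumberTheory.EllipticCurves.Aoki1999
  Literature.NumberTheory.EllipticCurves.HeathBrown1994
  Literature.NumberTheory.EllipticCurves.HeathBrown1994.Families
  Literature.NumberTheory.QuadraticForms

set_option autoImplicit false

namespace Summit.BirchSwinnertonDyer.Rank1Residual.P2.AokiMonsky

variable {k : ℕ} (p : Fin k → ℕ) (hp : ∀ i, (p i).Prime) (hinj : Function.Injective p)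

include hp hinj in
/-- `|T| = |T₁| + 1` for `n ≡ 7 (mod 8)` (`T = T₁ ∪ {2}`). [cite: Aoki1999, §2 p. 80] -/
theorem card_tSet_prod_seven (h7 : (∏ i, p i) % 8 = 7) :
    (tSet (∏ i, p i)).card = Fintype.card {i : Fin k // addLegendreSym (-1) (p i) = 0} + 1 := by
  have hodd := odd_of_prod_odd p (by omega)
  rw [tSet_prod_seven p hp hinj h7, Finset.card_insert_of_notMem, Finset.card_image_of_injective _ hinj,
    Fintype.card_subtype]
  · congr 2
    ext i
    simp only [Finset.mem_filter, Finset.mem_univ, true_and, eps_eq_zero_iff p hodd i]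
  · intro h
    obtain ⟨i, -, hi⟩ := Finset.mem_image.mp h
    exact prime_ne_two p hodd i hi

include hp hinj in
/-- **Aoki's Gram matrix at `(p_i, p_l)` for `n ≡ 7 (mod 8)`: `G_il = Σ_j ε_j (Aᵀ)_ij (Aᵀ)_lj + δ_il t_i`** (`ν = 0`).
[cite: Aoki1999, Thm. 2.2 p. 81, proof p. 98] -/
theorem gramMatrix_prime_prime_seven (h7 : (∏ i, p i) % 8 = 7) (i l : Fin k)
    (hi : p i ∈ sOneSet (∏ i, p i)) (hl : p l ∈ sOneSet (∏ i, p i)) :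
    gramMatrix (∏ i, p i) ⟨p i, hi⟩ ⟨p l, hl⟩ =
      (∑ j, addLegendreSym (-1) (p j) * ((legendreMatrix p)ᵀ i j * (legendreMatrix p)ᵀ l j)) +
        if i = l then addLegendreSym 2 (p i) else 0 := by
  have hodd := odd_of_prod_odd p (by omega)
  unfold gramMatrix
  rw [Matrix.of_apply]
  have hnu : nu (∏ i, p i) = 0 := by unfold nu; rw [if_neg (by omega)]
  rw [hnu, zero_mul, add_zero]
  congr 1
  · rw [Finset.sum_coe_sort (sTwoSet (∏ i, p i))
        (fun q => lam (∏ i, p i) q ((p i : ℕ) : ℤ) * lam (∏ i, p i) q ((p l : ℕ) : ℤ)),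
      sTwoSet_prod_seven p hp hodd hinj h7, Finset.sum_image fun x _ y _ h => hinj h, Finset.sum_filter]
    refine Finset.sum_congr rfl fun j _ => ?_
    rw [eps_eq_ite p hodd j]
    by_cases hj : p j % 4 = 1
    · rw [if_pos hj, if_neg (not_not.mpr hj), zero_mul]
    · rw [if_neg hj, if_pos hj, one_mul, lam_odd_eq_transpose_legendreMatrix p hp hodd hinj i j,
        lam_odd_eq_transpose_legendreMatrix p hp hodd hinj l j]
  · by_cases hil : i = l
    · subst hil
      rw [if_pos rfl, if_pos rfl, lam_two_prime p hp hodd]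
    · have hne : (⟨p i, hi⟩ : ↥(sOneSet (∏ i, p i))) ≠ ⟨p l, hl⟩ := fun h =>
        hil (hinj (Subtype.ext_iff.mp h))
      rw [if_neg hne, if_neg hil]

include hp hinj in
/-- **`v(Sel₀) ≅ W₇ = {u ∈ W₀ : t ⬝ u = 0, ε ⬝ u = 0}` and the Gram matrices correspond** (`n ≡ 7 (mod 8)`):
Aoki's conditions are `λ_q(x_w) = 0` for `q ∈ T₁` and `q = 2` (`= t ⬝ u`), and `x_w ≡ 1 (mod 8)` (`= t ⬝ u = 0 ∧ ε ⬝ u = 0`).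
[cite: Aoki1999, Thm. 2.2 p. 81, §2 p. 80, Thm. 4.1 p. 87] -/
theorem rank_gramEssential_prod_seven_eq (h7 : (∏ i, p i) % 8 = 7) :
    (gramEssential (∏ i, p i)).rank =
      (Matrix.of fun w w' : ↥(Finset.univ.filter fun u : Fin k → ZMod 2 =>
          (∀ j, addLegendreSym (-1) (p j) = 0 → (u ᵥ* (legendreMatrix p)ᵀ) j = 0) ∧
            (fun i => addLegendreSym 2 (p i)) ⬝ᵥ u = 0 ∧ (fun i => addLegendreSym (-1) (p i)) ⬝ᵥ u = 0) =>
        (w : Fin k → ZMod 2) ⬝ᵥ ((Matrix.of fun i l : Fin k =>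
          (∑ j, addLegendreSym (-1) (p j) * ((legendreMatrix p)ᵀ i j * (legendreMatrix p)ᵀ l j)) +
            if i = l then addLegendreSym 2 (p i) else 0) *ᵥ (w' : Fin k → ZMod 2))).rank := by
  have hodd := odd_of_prod_odd p (by omega)
  have hS1 := sOneSet_prod p hp hodd hinj
  have hT := tSet_prod_seven p hp hinj h7
  have hmemS : ∀ i, p i ∈ sOneSet (∏ i, p i) := fun i => by
    rw [hS1]; exact Finset.mem_image_of_mem _ (Finset.mem_univ i)
  let eS : Fin k ≃ ↥(sOneSet (∏ i, p i)) := Equiv.ofBijective (fun i => ⟨p i, hmemS i⟩)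
    ⟨fun i j h => hinj (Subtype.ext_iff.mp h), fun x => by
      obtain ⟨xv, hxv⟩ := x
      rw [hS1] at hxv
      obtain ⟨i, -, hi⟩ := Finset.mem_image.mp hxv
      exact ⟨i, Subtype.ext hi⟩⟩
  have heS : ∀ i, (eS i : ℕ) = p i := fun i => rfl
  have hn0 : (∏ i, p i) ≠ 0 := Finset.prod_ne_zero_iff.mpr fun i _ => (hp i).ne_zero
  have hlam : ∀ (u : Fin k → ZMod 2) (q : ℕ), lam (∏ i, p i) q
      (rep (∏ i, p i) fun x : ↥(sOneSet (∏ i, p i)) => u (eS.symm x)) =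
      ∑ i, u i * lam (∏ i, p i) q ((p i : ℕ) : ℤ) := by
    intro u q
    rw [lam_rep hn0]
    exact Fintype.sum_equiv eS.symm _ _ fun x => by rw [← heS (eS.symm x), Equiv.apply_symm_apply]
  have hlam2 : ∀ u : Fin k → ZMod 2,
      (∑ x : ↥(sOneSet (∏ i, p i)), (fun x => u (eS.symm x)) x * lam (∏ i, p i) 2 ((x : ℕ) : ℤ)) =
        (fun i => addLegendreSym 2 (p i)) ⬝ᵥ u := by
    intro u
    rw [← lam_rep hn0, hlam]
    simp only [dotProduct]
    exact Finset.sum_congr rfl fun i _ => by rw [lam_two_prime p hp hodd, mul_comm]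
  have hneg1 : ∀ u : Fin k → ZMod 2,
      (∑ x : ↥(sOneSet (∏ i, p i)), (fun x => u (eS.symm x)) x * hilbertBit 2 (-1) ((x : ℕ) : ℤ)) =
        (fun i => addLegendreSym (-1) (p i)) ⬝ᵥ u := by
    intro u
    simp only [dotProduct]
    refine Fintype.sum_equiv eS.symm _ _ fun x => ?_
    have hx : ((x : ℕ) : ℤ) = ((p (eS.symm x) : ℕ) : ℤ) := by rw [← heS (eS.symm x), Equiv.apply_symm_apply]
    rw [hx, hilbertBit_two_neg_one_prime p hodd, mul_comm]
  have hmemW : ∀ u : Fin k → ZMod 2,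
      (fun x : ↥(sOneSet (∏ i, p i)) => u (eS.symm x)) ∈ essential (∏ i, p i) ↔
        (∀ j, addLegendreSym (-1) (p j) = 0 → (u ᵥ* (legendreMatrix p)ᵀ) j = 0) ∧
          (fun i => addLegendreSym 2 (p i)) ⬝ᵥ u = 0 ∧ (fun i => addLegendreSym (-1) (p i)) ⬝ᵥ u = 0 := by
    intro u
    unfold essential
    rw [Finset.mem_filter]
    simp only [Finset.mem_univ, true_and]
    rw [essentialCond_prod_seven_iff p hp hodd hinj h7, hlam2, hneg1, hT, Finset.forall_mem_insert, hlam]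
    have hT₁ : (∀ q ∈ (Finset.univ.filter fun i => p i % 4 = 1).image p,
        lam (∏ i, p i) q (rep (∏ i, p i) fun x : ↥(sOneSet (∏ i, p i)) => u (eS.symm x)) = 0) ↔
        ∀ j, addLegendreSym (-1) (p j) = 0 → (u ᵥ* (legendreMatrix p)ᵀ) j = 0 := by
      constructor
      · intro h j hj
        have hq : p j ∈ (Finset.univ.filter fun i => p i % 4 = 1).image p :=
          Finset.mem_image_of_mem _ (Finset.mem_filter.mpr ⟨Finset.mem_univ _, (eps_eq_zero_iff p hodd j).mp hj⟩)
        have := h (p j) hq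
        rw [hlam] at this
        rw [← this]
        simp only [Matrix.vecMul, dotProduct]
        exact Finset.sum_congr rfl fun i _ => by rw [lam_odd_eq_transpose_legendreMatrix p hp hodd hinj i j]
      · intro h q hq
        obtain ⟨j, hj, rfl⟩ := Finset.mem_image.mp hq
        have hεj : addLegendreSym (-1) (p j) = 0 :=
          (eps_eq_zero_iff p hodd j).mpr (Finset.mem_filter.mp hj).2
        rw [hlam, ← h j hεj]
        simp only [Matrix.vecMul, dotProduct]
        exact Finset.sum_congr rfl fun i _ => by rw [lam_odd_eq_transpose_legendreMatrix p hp hodd hinj i j]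
    rw [hT₁]
    have ht2 : (∑ i, u i * lam (∏ i, p i) 2 ((p i : ℕ) : ℤ)) = (fun i => addLegendreSym 2 (p i)) ⬝ᵥ u := by
      simp only [dotProduct]
      exact Finset.sum_congr rfl fun i _ => by rw [lam_two_prime p hp hodd, mul_comm]
    rw [ht2]
    tauto
  have hWfin : ∀ u : Fin k → ZMod 2, u ∈ (Finset.univ.filter fun u : Fin k → ZMod 2 =>
      (∀ j, addLegendreSym (-1) (p j) = 0 → (u ᵥ* (legendreMatrix p)ᵀ) j = 0) ∧
        (fun i => addLegendreSym 2 (p i)) ⬝ᵥ u = 0 ∧ (fun i => addLegendreSym (-1) (p i)) ⬝ᵥ u = 0) ↔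
      (∀ j, addLegendreSym (-1) (p j) = 0 → (u ᵥ* (legendreMatrix p)ᵀ) j = 0) ∧
        (fun i => addLegendreSym 2 (p i)) ⬝ᵥ u = 0 ∧ (fun i => addLegendreSym (-1) (p i)) ⬝ᵥ u = 0 :=
    fun u => by rw [Finset.mem_filter]; simp only [Finset.mem_univ, true_and]
  have hback : ∀ w : ↥(sOneSet (∏ i, p i)) → ZMod 2,
      (fun x : ↥(sOneSet (∏ i, p i)) => (fun i => w (eS i)) (eS.symm x)) = w :=
    fun w => funext fun x => by simp only [Equiv.apply_symm_apply]
  let eW : ↥(Finset.univ.filter fun u : Fin k → ZMod 2 =>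
      (∀ j, addLegendreSym (-1) (p j) = 0 → (u ᵥ* (legendreMatrix p)ᵀ) j = 0) ∧
        (fun i => addLegendreSym 2 (p i)) ⬝ᵥ u = 0 ∧ (fun i => addLegendreSym (-1) (p i)) ⬝ᵥ u = 0) ≃
      ↥(essential (∏ i, p i)) :=
    { toFun := fun u => ⟨fun x => (u : Fin k → ZMod 2) (eS.symm x), (hmemW _).mpr ((hWfin _).mp u.2)⟩
      invFun := fun w => ⟨fun i => (w : ↥(sOneSet (∏ i, p i)) → ZMod 2) (eS i),
        (hWfin _).mpr ((hmemW _).mp (by rw [hback]; exact w.2))⟩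
      left_inv := fun u => Subtype.ext (funext fun i => by simp only [Equiv.symm_apply_apply])
      right_inv := fun w => Subtype.ext (hback _) }
  rw [← Matrix.rank_submatrix (gramEssential (∏ i, p i)) eW eW]
  congr 1
  ext u u'
  rw [Matrix.submatrix_apply, Matrix.of_apply]
  unfold gramEssential
  rw [Matrix.of_apply]
  change (fun x => (u : Fin k → ZMod 2) (eS.symm x)) ⬝ᵥ (gramMatrix (∏ i, p i) *ᵥ
      fun x => (u' : Fin k → ZMod 2) (eS.symm x)) = _
  simp only [dotProduct, Matrix.mulVec, Matrix.of_apply]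
  refine (Fintype.sum_equiv eS _ _ fun i => ?_).symm
  rw [Equiv.symm_apply_apply]
  congr 1
  refine Fintype.sum_equiv eS _ _ fun l => ?_
  rw [Equiv.symm_apply_apply]
  congr 1
  exact (gramMatrix_prime_prime_seven p hp hinj h7 i l (hmemS i) (hmemS l)).symm

include hp hinj in
/-- **AOKI = MONSKY ON THE CLASS `n ≡ 7 (mod 8)`, for every `k`** — completing Aoki's typed range
`n ≡ 3, 6, 7 (mod 8)`. [cite: Aoki1999, Thm. 2.2 p. 81 and its proof p. 98]
[cite: HeathBrown1994SelmerCongruentII, Appendix (Monsky), typescript p. 39 L10–L33] -/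
theorem selmerDimFormula_prod_seven (h7 : (∏ i, p i) % 8 = 7) :
    selmerDimFormula (∏ i, p i) = 2 + (monskySelmerRankOdd p : ℤ) := by
  have hodd := odd_of_prod_odd p (by omega)
  have hK := finrank_ker_odd_add_two_mul_rank_add_rank_gram (legendreMatrix p)ᵀ
    (fun i => addLegendreSym (-1) (p i)) (fun i => addLegendreSym 2 (p i))
    (transposeA_hLT p hp hodd hinj) (transposeA_sum_col p)
    (sum_eps_eq_one_of_prod_mod_four p hodd (by omega))
    (Matrix.of fun i l : Fin k =>
      (∑ j, addLegendreSym (-1) (p j) * ((legendreMatrix p)ᵀ i j * (legendreMatrix p)ᵀ l j)) +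
        if i = l then addLegendreSym 2 (p i) else 0)
    (fun i l => rfl)
    (Finset.univ.filter fun u : Fin k → ZMod 2 =>
      ∀ j, addLegendreSym (-1) (p j) = 0 → (u ᵥ* (legendreMatrix p)ᵀ) j = 0)
    (fun u => by rw [Finset.mem_filter]; simp only [Finset.mem_univ, true_and])
  have hs : monskySelmerRankOdd p = Module.finrank (ZMod 2) ↥(LinearMap.ker (Matrix.fromBlocks
      ((legendreMatrix p)ᵀᵀ + Matrix.diagonal fun i => addLegendreSym 2 (p i))
      (Matrix.diagonal fun i => addLegendreSym 2 (p i))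
      (Matrix.diagonal fun i => addLegendreSym 2 (p i))
      ((legendreMatrix p)ᵀᵀ + (Matrix.diagonal fun i => addLegendreSym 2 (p i)) +
        Matrix.diagonal fun i => addLegendreSym (-1) (p i))).mulVecLin) := by
    rw [monskySelmerRankOdd_eq_finrank_ker, monskyMatrixOdd_eq_fromBlocks p hp hodd]
  have hΓ := rank_gram_seven_add p h7
  have hΛ := rank_fromCols_single
    ((legendreMatrix p)ᵀ.submatrix id (Subtype.val : {j // addLegendreSym (-1) (p j) = 0} → Fin k))
    (fun i => addLegendreSym 2 (p i))
  rw [Fintype.card_fin] at hK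
  unfold selmerDimFormula
  rw [card_sSet_prod p hp hinj, card_tSet_prod_seven p hp hinj h7, rank_lamMatrix_prod_seven_eq p hp hinj h7, hΛ,
    rank_gramEssential_prod_seven_eq p hp hinj h7, hs]
  obtain ⟨δ, hδdef⟩ : ∃ δ : ℕ, (if (fun i => addLegendreSym 2 (p i)) ∈ LinearMap.range
      ((legendreMatrix p)ᵀ.submatrix id (Subtype.val : {j // addLegendreSym (-1) (p j) = 0} → Fin k)).mulVecLin
      then 0 else 1) = δ := ⟨_, rfl⟩
  have hδ1 : δ ≤ 1 := by rw [← hδdef]; split_ifs <;> omega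
  rw [hδdef] at hΓ ⊢
  push_cast
  omega

/-- **`#Sel₂(E_{p₁⋯p_k}/ℚ) = 2^{2 + s_odd(p₁⋯p_k)}` for `n ≡ 7 (mod 8)`, every `k`, from Aoki's Theorem 2.2 alone.**
[cite: Aoki1999, Thm. 2.2 p. 81] [cite: HeathBrown1994SelmerCongruentII, Appendix (Monsky), typescript p. 39 L10–L33] -/
theorem card_selmerGroup_two_prod_seven_of_aoki (hAo : thm22_card_selmerGroup_two)
    {k : ℕ} (p : Fin k → ℕ) (hp : ∀ i, (p i).Prime) (hinj : Function.Injective p)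
    (h7 : (∏ i, p i) % 8 = 7) :
    Nat.card ((congruentNumberCurve (∏ i, p i)).selmerGroup 2) = 2 ^ (2 + monskySelmerRankOdd p) := by
  obtain ⟨d, hd, hd'⟩ := hAo (∏ i, p i)
    (Nat.pos_of_ne_zero (Finset.prod_ne_zero_iff.mpr fun i _ => (hp i).ne_zero))
    (squarefree_prod_of_injective p hp hinj) (Or.inr (Or.inr h7))
  rw [selmerDimFormula_prod_seven p hp hinj h7] at hd'
  have hd2 : d = 2 + monskySelmerRankOdd p := by omega
  rw [hd, hd2]

end Summit.BirchSwinnertonDyer.Rank1Residual.P2.AokiMonsky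

end
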